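import Summits.QuantumFields.YangMills.Theorems.UnitScaleTiltProp7DeltaEtaStarReality
import Summits.QuantumFields.YangMills.Theorems.UnitScaleTiltProp7QTwSScalarSectorRegPr
import HarnessLib

/-!
# Route `UnitScaleTilt`, crux K1 child «MinimiserStabilityRegPr» (stmt-QuantumFields-19200), skeleton v10, stub `stub_existenceMinimalOrbit` (EX),
# route (α) — **THE (R-H) CLAUSE OF THE EX KNIT'S `h46tw` FOR PRINT'S `H(U₀) := H46 U₀`, UNCONDITIONAL AT EVERY PRINTED-REGULAR BACKGROUND** `U₀ ∈ 𝔘_k(ε₀)` in the two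
# windows of record `10⁹L²e ≤ 1`, `10¹²L³ε₀ ≤ 1`: «`H46 U₀` maps skew-Hermitian traceless block data to skew-Hermitian traceless fields»

Cell `ym3-torus`, width seat `ym-ust-20520-w4` (gen 4).  THEOREMS ONLY (0 `def`, 0 `sorry`).  The CLOSING corollary of the (a)∕(b) reality programme (ym-inputs-p03 g2 ∕ ★w4-20520 g4
split; ★w5-20520 g5's (Q-b); p01's layer-0 rows): ✓`Prop7DeltaEtaStarReality.H46_skewHermitian_traceless_of_regPr_of_realScalar` with its LAST displayed row (Q-b)ʳ `hscR` supplied BY NAME by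
★w5-20520 g5's ✓`Prop7SymAvgTwSym.QTwS_smul_one_real_of_regPr` (the centre-equivariance of the exp-mean-log tower, `…QTwSScalarSectorRegPr`).  Nothing here closes the stub;
`--supports stmt-QuantumFields-19200 --as helper`, count-neutral.  YM₃ on T³ is a ladder rung (R3), not the Clay problem; nothing here claims the stub, the crux, d = 4 or the gap.

THE PRINT.  [Balaban1985BackgroundPropagators] p. 393 «The operators … are real», (3.126) `H = GQ*(QGQ*)⁻¹`; [Balaban1985Variational] (45)–(46) p. 285, (51) p. 286.

WHAT IS PROVED (sorry-free, no definition).  ★★★ `H46_skewHermitian_traceless_at_regPr` — for `RegPr F n K ε₀ U₀`, `0 < e`, `10⁹L²e ≤ 1`, `10¹²L³ε₀ ≤ 1`: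
`∀ Y, (∀ c, star (Y c) = −Y c ∧ tr (Y c) = 0) → ∀ b, star (H46 … U₀ Y b) = −H46 … U₀ Y b ∧ tr (H46 … U₀ Y b) = 0` — NO displayed reality row left (the weights `c₀ cB a` free, as in the knit).
Chain by name: ✓`Prop7SectET3JcurReality` · ✓`Prop7QTwSReality` ((Q-a)) · ✓`Prop7SectET3PropagatorsReality` · ✓`Prop7H46Reality` · ✓`Prop7H46RealityTrace` · ✓`Prop7WilsonHessianSectorRows` (`Δ^η` traceless
sector) · ✓`Prop7DeltaEtaStarReality` (this seat) ∘ p03 ✓`B11Eq103H1ComplexReality`∕`…HilbertLettersT3Reality`∕`…QTwSRealitySectors` ∘ p01 ✓`…WilsonHessianT3RealityRows`∕`…SigmaRows` ∘ ★w5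
✓`…EMLTowerCentral`∕`…QTwSScalarSector(RegPr)`.

References: T. Bałaban, CMP 99 (1985) 389–434 [Balaban1985BackgroundPropagators] (p.393, (3.126) p.420); CMP 102 (1985) 277–309 [Balaban1985Variational] ((45)–(46) p.285, (51) p.286).
-/

set_option autoImplicit false

noncomputable section

open scoped InnerProductSpace ComplexConjugate Matrix.Norms.L2Operator BigOperators

namespace Summit.QuantumFields.YangMills.Theorems.Prop7H46RealityClause

open Literature.MathematicalPhysics.QuantumFieldTheory.Balaban1983to89
open Literature.MathematicalPhysics.QuantumFieldTheory.Balaban1983to89.T3ContinuumYM3Torus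
open T3PrintedRegularMinimiser (RegPr)
open Summit.QuantumFields.YangMills.Theorems.Prop7SectET3DeltaPi (H46)
open Summit.QuantumFields.YangMills.Theorems.Prop7DeltaEtaStarReality (H46_skewHermitian_traceless_of_regPr_of_realScalar)
open Summit.QuantumFields.YangMills.Theorems.Prop7SymAvgTwSym (QTwS_smul_one_real_of_regPr)

variable (F : T3Family) {n K : ℕ} (h : n ≤ K) (c₀ cB a : ℝ) [Fact (0 < c₀)] [Fact (0 < cB)]

/-- ★★★ **THE (R-H) CLAUSE FOR `H := H46 U₀` — UNCONDITIONAL AT EVERY `U₀ ∈ 𝔘_k(ε₀)` IN THE TWO WINDOWS**: print's `H(U₀) = GQ*(QGQ*)⁻¹` on the symmetric covariant tube maps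
skew-Hermitian traceless block data to skew-Hermitian traceless fields. [cite: Balaban1985BackgroundPropagators, p.393, (3.126) p.420; Balaban1985Variational, (45)–(46) p.285, (51) p.286] -/
theorem H46_skewHermitian_traceless_at_regPr [Fact (0 < (F.L : ℝ))] [Fact (0 < ((F.L : ℝ)⁻¹) ^ (K - n))]
    {ε₀ e : ℝ} (hε₀ : 0 < ε₀) (he : 0 < e) (hWe : 10 ^ 9 * (F.L : ℝ) ^ 2 * e ≤ 1) (hWε : 10 ^ 12 * (F.L : ℝ) ^ 3 * ε₀ ≤ 1)
    (U₀ : GaugeField (F.P K) 0 (Matrix.specialUnitaryGroup (Fin 2) ℂ)) (hreg : RegPr F n K ε₀ U₀) :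
    ∀ Y : PBond (F.P n) 0 → Matrix (Fin 2) (Fin 2) ℂ, (∀ c, star (Y c) = -Y c ∧ (Y c).trace = 0) →
      ∀ b, star (H46 F n K h c₀ cB a U₀ Y b) = -H46 F n K h c₀ cB a U₀ Y b ∧ (H46 F n K h c₀ cB a U₀ Y b).trace = 0 :=
  H46_skewHermitian_traceless_of_regPr_of_realScalar (F := F) (c₀ := c₀) h cB a hε₀ he hWe hWε U₀ hreg (QTwS_smul_one_real_of_regPr F h hε₀ hWε U₀ hreg)

end Summit.QuantumFields.YangMills.Theorems.Prop7H46RealityClause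

end
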